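import Summits.Ventures.HSemireg.WedgeHankelRecurrenceGaussChebyshevUCharP

/-!
# Venture HSemireg — **SCHUR'S TABLE OF CHEBYSHEV POLYNOMIALS AROUND THE CHARACTERISTIC: in every commutative ring of odd prime characteristic `p`,
# `T_{p+1} = X^{p+1} + (X²−1)^{(p+1)∕2}`, `T_{p−1} = X^{p+1} − (X²−1)^{(p+1)∕2}`, `U_p = X^p + X (X²−1)^{(p−1)∕2}`, `U_{p−2} = X (X²−1)^{(p−1)∕2} − X^p`, `U_{2p−1} = 2 X^p (X²−1)^{(p−1)∕2}`,
# `T_{2p} = 2 X^{2p} − 1`** — read off from `T_p = X^p` (N473), `U_{p−1} = (X²−1)^{(p−1)∕2}` (N474) and the three-term recurrences ∕ the mixed identities `T_{n+2} = X T_{n+1} − (1−X²) U_n`,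
# `U_{n+1} = X U_n + T_{n+1}`, `U_{2n−1} = 2 T_n U_{n−1}`, `T_{2n} = 2 T_n² − 1`

HONEST FRAMING. Part of the Lean index of the computation cell `pub-hsemireg` (seat p10 gen 48, Sunday typer «UNIFORM-IN-n»).  Polynomial algebra in characteristic `p` only; no variety, no
cohomology theory, no sheaf, no Ext group and no semiregularity map is constructed here; nothing here says that HC / HC_CM / HC_AV holds; no Literature fact (unproved `Prop`) is declared or
used.  Custodian versions as in `WedgeHankelSiegelIdeal` (1/3).
SOURCES (cited).  I. Schur, *Arithmetisches über die Tschebyscheffschen Polynome* (1931), §1; T. J. Rivlin, *Chebyshev Polynomials* (1990), §5.2.  Checked by hand at `p = 3`: `T_4 = 8x⁴ − 8x² + 1 ≡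
2x⁴ + x² + 1 = x⁴ + (x²−1)² (mod 3)`, `T_2 = 2x² − 1 ≡ x⁴ − (x⁴ − 2x² + 1)`… `= 2x² − 1 ✓`, `U_3 = 8x³ − 4x ≡ 2x³ − x = x³ + x(x² − 1) ✓`.
PROOF TYPED HERE.  N473 `chebyshevT_eq_X_pow_charP`; N474 `chebyshevU_pred_eq_pow_charP`; N438 `chebyshevT_mul_U`; Mathlib `T_eq_X_mul_T_sub_pol_U`, `T_add_two`, `U_eq_X_mul_U_add_T`, `U_add_two`,
`T_mul_T` (for `T_{2p}`), `pow_succ`.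
DEDUP DISCLOSURE (`rg -n 'chebyshevT_succ_prime_charP|chebyshevT_pred_prime_charP|chebyshevU_prime_charP|chebyshevU_prime_sub_two_charP|chebyshevU_two_mul_prime_pred_charP|chebyshevT_two_mul_prime_charP'
Summits Literature HarnessLib`, 2026-09-04): 0 hits for the 6 names below.

WHAT IS IN THE TREE.  N438, N473, N474.
THIS FILE (namespace `Summit.Ventures.HSemireg.Wedge.HankelOuter` continued; CHAINED on N474; 0 definitions):
* §1240 **`chebyshevT_succ_prime_charP`**, **`chebyshevT_pred_prime_charP`**, **`chebyshevU_prime_charP`**, **`chebyshevU_prime_sub_two_charP`**, **`chebyshevU_two_mul_prime_pred_charP`**,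
  **`chebyshevT_two_mul_prime_charP`**.
CAVEATS.  `p` odd.  Nothing Ext-side.  New names only.
-/

open Module Polynomial
open scoped Matrix Polynomial

namespace Summit.Ventures.HSemireg.Wedge.HankelOuter

/-! ## §1240. Schur's table: `T_{p±1}`, `U_p`, `U_{p−2}`, `U_{2p−1}`, `T_{2p}` in characteristic `p` -/

/-- **`T_{p+1} = X^{p+1} + (X² − 1)^{(p+1)∕2}`** in every commutative ring of odd prime characteristic `p`. [Schur 1931 §1; this file, §1240] -/
theorem chebyshevT_succ_prime_charP (R : Type*) [CommRing R] (p : ℕ) [hp : Fact p.Prime] [CharP R p] (hp2 : p ≠ 2) :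
    Polynomial.Chebyshev.T R ((p : ℤ) + 1) = Polynomial.X ^ (p + 1) + (Polynomial.X ^ 2 - 1) ^ ((p + 1) / 2) := by
  have hq : (p + 1) / 2 = (p - 1) / 2 + 1 := by
    have h1 := hp.out.one_le; omega
  have h := Polynomial.Chebyshev.T_eq_X_mul_T_sub_pol_U R ((p : ℤ) - 1)
  rw [show (p : ℤ) - 1 + 2 = (p : ℤ) + 1 by ring, sub_add_cancel, chebyshevT_eq_X_pow_charP R p hp2, chebyshevU_pred_eq_pow_charP R p hp2] at h
  rw [h, hq, pow_succ, pow_succ]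
  ring

/-- **`T_{p−1} = X^{p+1} − (X² − 1)^{(p+1)∕2}`** in every commutative ring of odd prime characteristic `p`. [Schur 1931 §1; this file, §1240] -/
theorem chebyshevT_pred_prime_charP (R : Type*) [CommRing R] (p : ℕ) [hp : Fact p.Prime] [CharP R p] (hp2 : p ≠ 2) :
    Polynomial.Chebyshev.T R ((p : ℤ) - 1) = Polynomial.X ^ (p + 1) - (Polynomial.X ^ 2 - 1) ^ ((p + 1) / 2) := by
  have h := Polynomial.Chebyshev.T_add_two R ((p : ℤ) - 1)
  rw [show (p : ℤ) - 1 + 2 = (p : ℤ) + 1 by ring, sub_add_cancel, chebyshevT_succ_prime_charP R p hp2, chebyshevT_eq_X_pow_charP R p hp2] at h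
  rw [pow_succ]
  linear_combination h

/-- **`U_p = X^p + X (X² − 1)^{(p−1)∕2}`** in every commutative ring of odd prime characteristic `p`. [Schur 1931 §1; this file, §1240] -/
theorem chebyshevU_prime_charP (R : Type*) [CommRing R] (p : ℕ) [Fact p.Prime] [CharP R p] (hp2 : p ≠ 2) :
    Polynomial.Chebyshev.U R (p : ℤ) = Polynomial.X ^ p + Polynomial.X * (Polynomial.X ^ 2 - 1) ^ ((p - 1) / 2) := by
  have h := Polynomial.Chebyshev.U_eq_X_mul_U_add_T R ((p : ℤ) - 1)
  rw [sub_add_cancel, chebyshevU_pred_eq_pow_charP R p hp2, chebyshevT_eq_X_pow_charP R p hp2] at h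
  rw [h]; ring

/-- **`U_{p−2} = X (X² − 1)^{(p−1)∕2} − X^p`** in every commutative ring of odd prime characteristic `p`. [Schur 1931 §1; this file, §1240] -/
theorem chebyshevU_prime_sub_two_charP (R : Type*) [CommRing R] (p : ℕ) [Fact p.Prime] [CharP R p] (hp2 : p ≠ 2) :
    Polynomial.Chebyshev.U R ((p : ℤ) - 2) = Polynomial.X * (Polynomial.X ^ 2 - 1) ^ ((p - 1) / 2) - Polynomial.X ^ p := by
  have h := Polynomial.Chebyshev.U_add_two R ((p : ℤ) - 2)
  rw [sub_add_cancel, show (p : ℤ) - 2 + 1 = (p : ℤ) - 1 by ring, chebyshevU_prime_charP R p hp2, chebyshevU_pred_eq_pow_charP R p hp2] at h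
  linear_combination h

/-- **`U_{2p−1} = 2 X^p (X² − 1)^{(p−1)∕2}`** in every commutative ring of odd prime characteristic `p` (`U_{2n−1} = 2 T_n U_{n−1}`). [Schur 1931 §1; this file, §1240] -/
theorem chebyshevU_two_mul_prime_pred_charP (R : Type*) [CommRing R] (p : ℕ) [Fact p.Prime] [CharP R p] (hp2 : p ≠ 2) :
    Polynomial.Chebyshev.U R (2 * (p : ℤ) - 1) = 2 * Polynomial.X ^ p * (Polynomial.X ^ 2 - 1) ^ ((p - 1) / 2) := by
  have h := chebyshevT_mul_U (R := R) (p : ℤ) ((p : ℤ) - 1)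
  rw [show (p : ℤ) - 1 + (p : ℤ) = 2 * (p : ℤ) - 1 by ring, show (p : ℤ) - 1 - (p : ℤ) = -1 by ring, Polynomial.Chebyshev.U_neg_one, add_zero,
    chebyshevT_eq_X_pow_charP R p hp2, chebyshevU_pred_eq_pow_charP R p hp2] at h
  rw [← h]

/-- **`T_{2p} = 2 X^{2p} − 1`** in every commutative ring of odd prime characteristic `p` (`T_{2n} = 2 T_n² − 1`). [Schur 1931 §1; this file, §1240] -/
theorem chebyshevT_two_mul_prime_charP (R : Type*) [CommRing R] (p : ℕ) [Fact p.Prime] [CharP R p] (hp2 : p ≠ 2) :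
    Polynomial.Chebyshev.T R (2 * (p : ℤ)) = 2 * Polynomial.X ^ (2 * p) - 1 := by
  have h := Polynomial.Chebyshev.T_mul_T R (p : ℤ) (p : ℤ)
  rw [show (p : ℤ) + (p : ℤ) = 2 * (p : ℤ) by ring, sub_self, Polynomial.Chebyshev.T_zero, chebyshevT_eq_X_pow_charP R p hp2] at h
  linear_combination (-1 : R[X]) * h

end Summit.Ventures.HSemireg.Wedge.HankelOuter
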